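import Summits.ABC.IUTFork.Conditional.Layer4OfS
import Summits.ABC.IUTFork.DAGC312k
import Summits.ABC.IUTFork.DAGC312q
import Summits.ABC.IUTFork.DAGL4a
import Summits.ABC.IUTFork.DAGL4b
import Summits.ABC.IUTFork.DAGL4p
import Summits.ABC.IUTFork.DAGL4q
import Summits.ABC.IUTFork.DAGL4r
import Summits.ABC.IUTFork.DAGL4s
import Summits.ABC.IUTFork.DAGL4t
import Summits.ABC.IUTFork.DAGL4u
import Summits.ABC.IUTFork.DAGL4v
import Summits.ABC.IUTFork.DAGXc
import HarnessLib

/-!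
# L4 layer certificate — KERNEL INHABITATION of the residual (`Layer4Residual` is a theorem of the index)

abc-iut cell, seat abc-iut-w6-d032 (row CERT-L4; parts `Conditional/Layer4OfSa.lean` p429820, `Layer4OfSb.lean` p429825, top
`Layer4OfS.lean` p430043). PROOF-ONLY companion (theorems only; no definition, no instance, no sorry, nothing restated).

WHAT THIS FILE SAYS — AND WHAT IT DOES NOT. The certificate's KERNEL NOTE («every RESIDUAL conjunct is an index `StatementOf` Prop of
LANDED theorems, hence kernel-inhabited by the index's `_part`/`_holds`; discharged vs residual is the DAG/NODES row STATUS — the layer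
lead's judgement that the typed theorems cover the printed item —, not kernel provability»; second read abc-iut-w5-d005 06:59:50Z,
probe of record) is made LITERAL here: `layer4ResidualA_inhabited`, `layer4ResidualB_inhabited`, `layer4Residual_inhabited`, and hence
`layer4Cone_inhabited : Layer4ConeA ∧ Layer4ConeB`, each assembled from the index witnesses BY NAME (terms only; 51 + 22 witnesses).
CONSEQUENCE for the apex `Conditional/AbcOfS` (abc-iut-plan / C-cert): the L4 binder `(h4 : Layer4Residual)` CAN be instantiated by
`layer4Residual_inhabited` — i.e. the L4 slice of the [IUTchIII] Cor 3.12 cone carries NO open KERNEL obligation at the index level.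
It does NOT say that the 73 residual NODES are discharged in the layer lead's sense: «r 73» counts nodes whose PRINT COVERAGE by the
typed-and-proved theorems is not yet certified (plan/L4/NODES.md, abc-iut-L4-lead), and that count is untouched by this file.  Whether
the apex keeps `h4` as a visible binder (scoreboard semantics) or instantiates it is the C lead's choice, not this file's.
HONEST FRAMING: proves nothing about print; typed ≠ proved-as-printed; indexed ≠ endorsed; inhabited ≠ lead-discharged; no side taken
on [IUTchIII] Cor. 3.12; nothing here says abc is proved or refuted. [claim: Mochizuki2012, status: disputed] (node texts).
-/

namespace Summit.ABC.IUTFork.Conditional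

open Summit.ABC.IUTFork.DAG

universe u₁ u₂ u₃ u₄

/-- `Layer4ResidualA` is KERNEL-INHABITED: its conjuncts (51 at part A v0) are index Props of LANDED theorems, witnessed BY NAME
(index `_part`/`_holds` terms). Inhabited ≠ lead-discharged (print coverage is the NODES status). [claim: Mochizuki2012, status: disputed] -/
theorem layer4ResidualA_inhabited : Layer4ResidualA.{u₁, u₂, u₃} := by
  -- ROBUST FORM: split the outer conjunction reducibly (index Props are never opened) and close each conjunct with an index witness BY
  -- NAME from a SUPERSET list = ALL part-A claim-node witnesses (the DAG-discharged ones FIRST, then the residual ones in conjunct order), so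
  -- that a later re-file of part A that MOVES conjuncts between Discharged and Residual (dag/NODES folds) or DROPS one never breaks this
  -- importer; only a brand-new index name requires re-filing this file first (witness prepended). A listed witness asserts nothing new.
  unfold Layer4ResidualA
  repeat' (with_reducible apply And.intro)
  all_goals first
    | with_reducible exact N_AbsTopIII_Def2_1_i_holds
    | with_reducible exact N_AbsTopIII_Def2_1_ii_holds
    | with_reducible exact N_AbsTopIII_Def2_1_iii_holds
    | with_reducible exact N_AbsTopIII_Def3_1_i_holds
    | with_reducible exact N_AbsTopIII_Def3_1_ii_holds
    | with_reducible exact N_AbsTopIII_Def3_1_iii_holds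
    | with_reducible exact N_AbsTopIII_Def3_1_iv_holds
    | with_reducible exact N_AbsTopIII_Def3_1_v_holds
    | with_reducible exact N_AbsTopIII_Def3_1_vi_holds
    | with_reducible exact N_AbsTopIII_Def3_5_i_holds
    | with_reducible exact N_AbsTopIII_Def3_5_ii_holds
    | with_reducible exact N_AbsTopIII_Def3_5_iii_holds
    | with_reducible exact N_AbsTopIII_Def3_5_iv_holds
    | with_reducible exact N_AbsTopIII_Def3_5_v_holds
    | with_reducible exact N_AbsTopIII_Def3_5_vi_holds
    | with_reducible exact N_AbsTopIII_Def4_1_iii_holds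
    | with_reducible exact N_AbsTopIII_Def4_1_iv_holds
    | with_reducible exact N_AbsTopIII_Def5_1_iii_holds
    | with_reducible exact N_AbsTopIII_Def5_1_iv_holds
    | with_reducible exact N_AbsTopIII_Def5_6_i_holds
    | with_reducible exact N_AbsTopIII_Cor1_10_ii_part
    | with_reducible exact N_AbsTopIII_Cor1_10_iii_part
    | with_reducible exact N_AbsTopIII_Cor2_3_i_part
    | with_reducible exact N_AbsTopIII_Cor2_4_part
    | with_reducible exact N_AbsTopIII_Cor2_7_part
    | with_reducible exact N_AbsTopIII_Cor2_9_part
    | with_reducible exact N_AbsTopIII_Cor3_6_ii_part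
    | with_reducible exact N_AbsTopIII_Cor3_6_iv_part
    | with_reducible exact N_AbsTopIII_Cor3_6_v_part
    | with_reducible exact N_AbsTopIII_Cor4_5_i_part
    | with_reducible exact N_AbsTopIII_Cor4_5_ii_part
    | with_reducible exact N_AbsTopIII_Cor4_5_iii_part
    | with_reducible exact N_AbsTopIII_Cor4_5_iv_part
    | with_reducible exact N_AbsTopIII_Cor4_5_v_part
    | with_reducible exact N_AbsTopIII_Cor5_10_i_part
    | with_reducible exact N_AbsTopIII_Cor5_10_ii_part
    | with_reducible exact N_AbsTopIII_Cor5_10_iv_part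
    | with_reducible exact N_AbsTopIII_Cor5_2_i_part
    | with_reducible exact N_AbsTopIII_Cor5_2_v_part
    | with_reducible exact N_AbsTopIII_Cor5_5_i_part
    | with_reducible exact N_AbsTopIII_Cor5_5_iv_part
    | with_reducible exact N_AbsTopIII_Cor5_5_v_part
    | with_reducible exact N_AbsTopIII_Def4_1_ii_part
    | with_reducible exact N_AbsTopIII_Def5_4_ii_part
    | with_reducible exact N_AbsTopIII_Def5_4_iii_part
    | with_reducible exact N_AbsTopIII_Def5_4_v_part
    | with_reducible exact N_AbsTopIII_Def5_4_vii_part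
    | with_reducible exact N_AbsTopIII_Prop1_1_i_part
    | with_reducible exact N_AbsTopIII_Prop1_3_part
    | with_reducible exact N_AbsTopIII_Prop1_4_i_part
    | with_reducible exact N_AbsTopIII_Prop1_4_ii_part
    | with_reducible exact N_AbsTopIII_Prop1_6_ii_part
    | with_reducible exact N_AbsTopIII_Prop2_2_ii_part
    | with_reducible exact N_AbsTopIII_Prop2_5_part
    | with_reducible exact N_AbsTopIII_Prop2_6_part
    | with_reducible exact N_AbsTopIII_Prop3_2_ii_part
    | with_reducible exact N_AbsTopIII_Prop3_2_iii_part
    | with_reducible exact N_AbsTopIII_Prop3_2_iv_part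
    | with_reducible exact N_AbsTopIII_Prop3_2_v_part
    | with_reducible exact N_AbsTopIII_Prop3_3_ii_part
    | with_reducible exact N_AbsTopIII_Prop4_2_i_part
    | with_reducible exact N_AbsTopIII_Prop4_2_ii_part
    | with_reducible exact N_AbsTopIII_Prop5_7_i_part
    | with_reducible exact N_AbsTopIII_Prop5_7_ii_part
    | with_reducible exact N_AbsTopIII_Prop5_8_i_part
    | with_reducible exact N_AbsTopIII_Prop5_8_ii_part
    | with_reducible exact N_AbsTopIII_Prop5_8_iii_part
    | with_reducible exact N_AbsTopIII_Prop5_8_iv_part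
    | with_reducible exact N_AbsTopIII_Prop5_8_v_part
    | with_reducible exact N_AbsTopIII_Prop5_8_vi_part
    | with_reducible exact N_AbsTopIII_Thm1_9_part

/-- `Layer4ResidualB` is KERNEL-INHABITED: its conjuncts (22 at part B v0, 24 at v1) are index Props of LANDED theorems, witnessed BY NAME
(index `_part`/`_holds` terms). Inhabited ≠ lead-discharged (print coverage is the NODES status). [claim: Mochizuki2012, status: disputed] -/
theorem layer4ResidualB_inhabited : Layer4ResidualB.{u₁, u₂, u₃} := by
  -- ROBUST FORM (v1'): split the outer conjunction (reducibly: the index Props themselves are never opened) and close each conjunct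
  -- with an index witness BY NAME from a SUPERSET list (the two DAGXc.lean-indexed nodes FIRST), so that this proof elaborates unchanged
  -- before and after part B v1 adds those two conjuncts — no tree breakage between the two filings; a listed witness asserts nothing new.
  unfold Layer4ResidualB
  repeat' (with_reducible apply And.intro)
  all_goals first
    | with_reducible exact N_AbsTopI_Ex4_8_i_holds
    | with_reducible exact N_AbsTopI_Ex4_8_ii_holds
    | with_reducible exact N_AbsAnab_Lem2_5_ii_part
    | with_reducible exact N_AbsTopI_Prop4_10_ii_part
    | with_reducible exact N_AbsAnab_Lem1_1_4_part
    | with_reducible exact N_AbsAnab_Lem1_3_1_part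
    | with_reducible exact N_AbsAnab_Lem1_3_8_part
    | with_reducible exact N_AbsAnab_Prop1_2_1_i_part
    | with_reducible exact N_AbsAnab_Prop1_2_1_ii_part
    | with_reducible exact N_AbsAnab_Prop1_2_1_iii_part
    | with_reducible exact N_AbsAnab_Prop1_2_1_iv_part
    | with_reducible exact N_AbsAnab_Prop1_2_1_v_part
    | with_reducible exact N_AbsAnab_Prop1_2_1_vi_part
    | with_reducible exact N_AbsAnab_Prop1_2_1_vii_holds
    | with_reducible exact N_AbsTopII_Cor3_3_ii_part
    | with_reducible exact N_AbsTopII_Cor3_3_iii_part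
    | with_reducible exact N_AbsTopI_Lem4_5_ii_part
    | with_reducible exact N_AbsTopI_Lem4_5_v_part
    | with_reducible exact N_AbsTopI_Prop2_3_ii_part
    | with_reducible exact N_AbsTopI_Prop4_10_iv_part
    | with_reducible exact N_AbsTopI_Prop4_10_v_part
    | with_reducible exact N_AbsTopI_Thm2_6_i_part
    | with_reducible exact N_AbsTopI_Thm2_6_ii_part
    | with_reducible exact N_AbsTopI_Thm2_6_iv_part
    | with_reducible exact N_AbsTopI_Thm2_6_v_part
    | with_reducible exact N_AbsTopI_Thm2_6_vi_part

/-- `Layer4Residual` (the apex's ONE L4 binder) is KERNEL-INHABITED. Inhabited ≠ lead-discharged. [claim: Mochizuki2012, status: disputed] -/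
theorem layer4Residual_inhabited : Layer4Residual.{u₁, u₂, u₃} :=
  ⟨layer4ResidualA_inhabited, layer4ResidualB_inhabited⟩

/-- The whole L4 slice of the Cor 3.12 cone, AT THE INDEX LEVEL, is a kernel theorem: `Layer4ConeA ∧ Layer4ConeB` outright
(`layer4Cone_of` applied to `layer4Residual_inhabited`). Index level ≠ print coverage; no node status moves. [claim: Mochizuki2012, status: disputed] -/
theorem layer4Cone_inhabited : Layer4ConeA.{u₁, u₂, u₃, u₄} ∧ Layer4ConeB.{u₁, u₂, u₃} :=
  layer4Cone_of layer4Residual_inhabited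

/-! ## v1 companion (APPEND-ONLY, 2026-08-26): kernel inhabitation of the CURRENT residual `Layer4ResidualA1` / `Layer4ResidualB1` / `Layer4Residual1`
(v1 parts `Conditional/Layer4OfSa1.lean` / `Layer4OfSb1.lean`, top v1 section of `Conditional/Layer4OfS.lean`). -/

/-- `Layer4ResidualA1` is KERNEL-INHABITED (robust form: reducible `And.intro` split; each conjunct closed by an index witness BY NAME from the
superset list of ALL slice-A v1 claim-node witnesses, discharged ones first). Inhabited ≠ lead-discharged. [claim: Mochizuki2012, status: disputed] -/
theorem layer4ResidualA1_inhabited : Layer4ResidualA1.{u₁, u₂, u₃} := by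
  unfold Layer4ResidualA1
  repeat' (with_reducible apply And.intro)
  all_goals first
    | with_reducible exact N_AbsTopIII_Cor1_10_ii_part
    | with_reducible exact N_AbsTopIII_Cor2_3_i_part
    | with_reducible exact N_AbsTopIII_Cor4_5_i_part
    | with_reducible exact N_AbsTopIII_Cor4_5_iii_part
    | with_reducible exact N_AbsTopIII_Cor5_5_i_part
    | with_reducible exact N_AbsTopIII_Cor5_5_v_part
    | with_reducible exact N_AbsTopIII_Def2_1_i_holds
    | with_reducible exact N_AbsTopIII_Def2_1_ii_holds
    | with_reducible exact N_AbsTopIII_Def2_1_iii_holds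
    | with_reducible exact N_AbsTopIII_Def3_1_i_holds
    | with_reducible exact N_AbsTopIII_Def3_1_ii_holds
    | with_reducible exact N_AbsTopIII_Def3_1_iii_holds
    | with_reducible exact N_AbsTopIII_Def3_1_iv_holds
    | with_reducible exact N_AbsTopIII_Def3_1_v_holds
    | with_reducible exact N_AbsTopIII_Def3_1_vi_holds
    | with_reducible exact N_AbsTopIII_Def3_5_i_holds
    | with_reducible exact N_AbsTopIII_Def3_5_ii_holds
    | with_reducible exact N_AbsTopIII_Def3_5_iii_holds
    | with_reducible exact N_AbsTopIII_Def3_5_iv_holds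
    | with_reducible exact N_AbsTopIII_Def3_5_v_holds
    | with_reducible exact N_AbsTopIII_Def3_5_vi_holds
    | with_reducible exact N_AbsTopIII_Def4_1_iii_holds
    | with_reducible exact N_AbsTopIII_Def4_1_iv_holds
    | with_reducible exact N_AbsTopIII_Def5_1_iii_holds
    | with_reducible exact N_AbsTopIII_Def5_1_iv_holds
    | with_reducible exact N_AbsTopIII_Def5_6_i_holds
    | with_reducible exact N_AbsTopIII_Prop1_3_part
    | with_reducible exact N_AbsTopIII_Prop2_2_ii_part
    | with_reducible exact N_AbsTopIII_Prop2_5_part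
    | with_reducible exact N_AbsTopIII_Prop2_6_part
    | with_reducible exact N_AbsTopIII_Prop5_7_i_part
    | with_reducible exact N_AbsTopIII_Prop5_8_iv_part
    | with_reducible exact N_AbsTopIII_Prop5_8_v_part
    | with_reducible exact N_AbsTopIII_Prop5_8_vi_part
    | with_reducible exact N_AbsTopIII_Cor1_10_iii_part
    | with_reducible exact N_AbsTopIII_Cor2_4_part
    | with_reducible exact N_AbsTopIII_Cor2_7_part
    | with_reducible exact N_AbsTopIII_Cor2_9_part
    | with_reducible exact N_AbsTopIII_Cor3_6_ii_part
    | with_reducible exact N_AbsTopIII_Cor3_6_iv_part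
    | with_reducible exact N_AbsTopIII_Cor3_6_v_part
    | with_reducible exact N_AbsTopIII_Cor4_5_ii_part
    | with_reducible exact N_AbsTopIII_Cor4_5_iv_part
    | with_reducible exact N_AbsTopIII_Cor4_5_v_part
    | with_reducible exact N_AbsTopIII_Cor5_10_i_part
    | with_reducible exact N_AbsTopIII_Cor5_10_ii_part
    | with_reducible exact N_AbsTopIII_Cor5_10_iv_part
    | with_reducible exact N_AbsTopIII_Cor5_2_i_part
    | with_reducible exact N_AbsTopIII_Cor5_2_v_part
    | with_reducible exact N_AbsTopIII_Cor5_5_iv_part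
    | with_reducible exact N_AbsTopIII_Def4_1_ii_part
    | with_reducible exact N_AbsTopIII_Def5_4_ii_part
    | with_reducible exact N_AbsTopIII_Def5_4_iii_part
    | with_reducible exact N_AbsTopIII_Def5_4_v_part
    | with_reducible exact N_AbsTopIII_Def5_4_vii_part
    | with_reducible exact N_AbsTopIII_Prop1_1_i_part
    | with_reducible exact N_AbsTopIII_Prop1_4_i_part
    | with_reducible exact N_AbsTopIII_Prop1_4_ii_part
    | with_reducible exact N_AbsTopIII_Prop1_6_ii_part
    | with_reducible exact N_AbsTopIII_Prop3_2_ii_part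
    | with_reducible exact N_AbsTopIII_Prop3_2_iii_part
    | with_reducible exact N_AbsTopIII_Prop3_2_iv_part
    | with_reducible exact N_AbsTopIII_Prop3_2_v_part
    | with_reducible exact N_AbsTopIII_Prop3_3_ii_part
    | with_reducible exact N_AbsTopIII_Prop4_2_i_part
    | with_reducible exact N_AbsTopIII_Prop4_2_ii_part
    | with_reducible exact N_AbsTopIII_Prop5_7_ii_part
    | with_reducible exact N_AbsTopIII_Prop5_8_i_part
    | with_reducible exact N_AbsTopIII_Prop5_8_ii_part
    | with_reducible exact N_AbsTopIII_Prop5_8_iii_part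
    | with_reducible exact N_AbsTopIII_Thm1_9_part

/-- `Layer4ResidualB1` is KERNEL-INHABITED (robust form: reducible `And.intro` split; each conjunct closed by an index witness BY NAME from the
superset list of ALL slice-B v1 claim-node witnesses, discharged ones first). Inhabited ≠ lead-discharged. [claim: Mochizuki2012, status: disputed] -/
theorem layer4ResidualB1_inhabited : Layer4ResidualB1.{u₁, u₂} := by
  unfold Layer4ResidualB1
  repeat' (with_reducible apply And.intro)
  all_goals first
    | with_reducible exact N_AbsAnab_Lem1_1_4_part
    | with_reducible exact N_AbsAnab_Prop1_2_1_i_part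
    | with_reducible exact N_AbsAnab_Prop1_2_1_ii_part
    | with_reducible exact N_AbsAnab_Prop1_2_1_v_part
    | with_reducible exact N_AbsAnab_Prop1_2_1_vi_part
    | with_reducible exact N_AbsAnab_Prop1_2_1_vii_holds
    | with_reducible exact N_AbsAnab_Prop1_2_1_vii_L00_holds
    | with_reducible exact N_AbsAnab_Prop1_2_1_vii_L01a_holds
    | with_reducible exact N_AbsAnab_Prop1_2_1_vii_L01b_holds
    | with_reducible exact N_AbsAnab_Prop1_2_1_vii_L02_holds
    | with_reducible exact N_AbsAnab_Prop1_2_1_vii_L03_holds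
    | with_reducible exact N_AbsAnab_Prop1_2_1_vii_L04_holds
    | with_reducible exact N_AbsAnab_Prop1_2_1_vii_L05_holds
    | with_reducible exact N_AbsAnab_Prop1_2_1_vii_L06_holds
    | with_reducible exact N_AbsAnab_Prop1_2_1_vii_L06a_holds
    | with_reducible exact N_AbsAnab_Prop1_2_1_vii_L07_holds
    | with_reducible exact N_AbsAnab_Prop1_2_1_vii_L08_holds
    | with_reducible exact N_AbsAnab_Prop1_2_1_vii_L09_holds
    | with_reducible exact N_AbsAnab_Prop1_2_1_vii_L09a_holds
    | with_reducible exact N_AbsAnab_Prop1_2_1_vii_L10_holds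
    | with_reducible exact N_AbsTopI_Ex4_8_i_holds
    | with_reducible exact N_AbsTopI_Ex4_8_ii_holds
    | with_reducible exact N_AbsTopI_Lem4_5_ii_part
    | with_reducible exact N_AbsTopI_Thm2_6_ii_part
    | with_reducible exact N_AbsTopI_Thm2_6_v_part
    | with_reducible exact N_AbsAnab_Lem1_3_1_part
    | with_reducible exact N_AbsAnab_Lem1_3_8_part
    | with_reducible exact N_AbsAnab_Lem2_5_ii_part
    | with_reducible exact N_AbsAnab_Prop1_2_1_iii_part
    | with_reducible exact N_AbsAnab_Prop1_2_1_iv_part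
    | with_reducible exact N_AbsTopII_Cor3_3_ii_part
    | with_reducible exact N_AbsTopII_Cor3_3_iii_part
    | with_reducible exact N_AbsTopI_Lem4_5_v_part
    | with_reducible exact N_AbsTopI_Prop2_3_ii_part
    | with_reducible exact N_AbsTopI_Prop4_10_ii_part
    | with_reducible exact N_AbsTopI_Prop4_10_iv_part
    | with_reducible exact N_AbsTopI_Prop4_10_v_part
    | with_reducible exact N_AbsTopI_Thm2_6_i_part
    | with_reducible exact N_AbsTopI_Thm2_6_iv_part
    | with_reducible exact N_AbsTopI_Thm2_6_vi_part

/-- `Layer4Residual1` (the apex's ONE L4 binder at v1) is KERNEL-INHABITED. Inhabited ≠ lead-discharged. [claim: Mochizuki2012, status: disputed] -/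
theorem layer4Residual1_inhabited : Layer4Residual1.{u₁, u₂, u₃} :=
  ⟨layer4ResidualA1_inhabited, layer4ResidualB1_inhabited⟩

/-- The whole L4 slice at v1, AT THE INDEX LEVEL, is a kernel theorem: `Layer4ConeA1 ∧ Layer4ConeB1`. [claim: Mochizuki2012, status: disputed] -/
theorem layer4Cone1_inhabited : Layer4ConeA1.{u₁, u₂, u₃, u₄} ∧ Layer4ConeB1.{u₁, u₂, u₃} :=
  layer4Cone1_of layer4Residual1_inhabited

/-! ## v2 companion (APPEND-ONLY, 2026-08-26): kernel inhabitation of the CURRENT residual `Layer4ResidualA2` / `Layer4Residual2`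
(v2 part A `Conditional/Layer4OfSa2.lean`; part B unchanged at v1, `layer4ResidualB1_inhabited` above; top v2 section of `Conditional/Layer4OfS.lean`). -/

/-- `Layer4ResidualA2` is KERNEL-INHABITED (robust form: reducible `And.intro` split; each conjunct closed by an index witness BY NAME from the
superset list of ALL slice-A claim-node witnesses — the v1 list, unchanged: the index did not move between v1 and v2). Inhabited ≠ lead-discharged.
[claim: Mochizuki2012, status: disputed] -/
theorem layer4ResidualA2_inhabited : Layer4ResidualA2.{u₁, u₂, u₃} := by
  unfold Layer4ResidualA2
  repeat' (with_reducible apply And.intro)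
  all_goals first
    | with_reducible exact N_AbsTopIII_Cor1_10_ii_part
    | with_reducible exact N_AbsTopIII_Cor2_3_i_part
    | with_reducible exact N_AbsTopIII_Cor4_5_i_part
    | with_reducible exact N_AbsTopIII_Cor4_5_iii_part
    | with_reducible exact N_AbsTopIII_Cor5_5_i_part
    | with_reducible exact N_AbsTopIII_Cor5_5_v_part
    | with_reducible exact N_AbsTopIII_Def2_1_i_holds
    | with_reducible exact N_AbsTopIII_Def2_1_ii_holds
    | with_reducible exact N_AbsTopIII_Def2_1_iii_holds
    | with_reducible exact N_AbsTopIII_Def3_1_i_holds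
    | with_reducible exact N_AbsTopIII_Def3_1_ii_holds
    | with_reducible exact N_AbsTopIII_Def3_1_iii_holds
    | with_reducible exact N_AbsTopIII_Def3_1_iv_holds
    | with_reducible exact N_AbsTopIII_Def3_1_v_holds
    | with_reducible exact N_AbsTopIII_Def3_1_vi_holds
    | with_reducible exact N_AbsTopIII_Def3_5_i_holds
    | with_reducible exact N_AbsTopIII_Def3_5_ii_holds
    | with_reducible exact N_AbsTopIII_Def3_5_iii_holds
    | with_reducible exact N_AbsTopIII_Def3_5_iv_holds
    | with_reducible exact N_AbsTopIII_Def3_5_v_holds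
    | with_reducible exact N_AbsTopIII_Def3_5_vi_holds
    | with_reducible exact N_AbsTopIII_Def4_1_iii_holds
    | with_reducible exact N_AbsTopIII_Def4_1_iv_holds
    | with_reducible exact N_AbsTopIII_Def5_1_iii_holds
    | with_reducible exact N_AbsTopIII_Def5_1_iv_holds
    | with_reducible exact N_AbsTopIII_Def5_6_i_holds
    | with_reducible exact N_AbsTopIII_Prop1_3_part
    | with_reducible exact N_AbsTopIII_Prop2_2_ii_part
    | with_reducible exact N_AbsTopIII_Prop2_5_part
    | with_reducible exact N_AbsTopIII_Prop2_6_part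
    | with_reducible exact N_AbsTopIII_Prop5_7_i_part
    | with_reducible exact N_AbsTopIII_Prop5_8_iv_part
    | with_reducible exact N_AbsTopIII_Prop5_8_v_part
    | with_reducible exact N_AbsTopIII_Prop5_8_vi_part
    | with_reducible exact N_AbsTopIII_Cor1_10_iii_part
    | with_reducible exact N_AbsTopIII_Cor2_4_part
    | with_reducible exact N_AbsTopIII_Cor2_7_part
    | with_reducible exact N_AbsTopIII_Cor2_9_part
    | with_reducible exact N_AbsTopIII_Cor3_6_ii_part
    | with_reducible exact N_AbsTopIII_Cor3_6_iv_part
    | with_reducible exact N_AbsTopIII_Cor3_6_v_part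
    | with_reducible exact N_AbsTopIII_Cor4_5_ii_part
    | with_reducible exact N_AbsTopIII_Cor4_5_iv_part
    | with_reducible exact N_AbsTopIII_Cor4_5_v_part
    | with_reducible exact N_AbsTopIII_Cor5_10_i_part
    | with_reducible exact N_AbsTopIII_Cor5_10_ii_part
    | with_reducible exact N_AbsTopIII_Cor5_10_iv_part
    | with_reducible exact N_AbsTopIII_Cor5_2_i_part
    | with_reducible exact N_AbsTopIII_Cor5_2_v_part
    | with_reducible exact N_AbsTopIII_Cor5_5_iv_part
    | with_reducible exact N_AbsTopIII_Def4_1_ii_part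
    | with_reducible exact N_AbsTopIII_Def5_4_ii_part
    | with_reducible exact N_AbsTopIII_Def5_4_iii_part
    | with_reducible exact N_AbsTopIII_Def5_4_v_part
    | with_reducible exact N_AbsTopIII_Def5_4_vii_part
    | with_reducible exact N_AbsTopIII_Prop1_1_i_part
    | with_reducible exact N_AbsTopIII_Prop1_4_i_part
    | with_reducible exact N_AbsTopIII_Prop1_4_ii_part
    | with_reducible exact N_AbsTopIII_Prop1_6_ii_part
    | with_reducible exact N_AbsTopIII_Prop3_2_ii_part
    | with_reducible exact N_AbsTopIII_Prop3_2_iii_part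
    | with_reducible exact N_AbsTopIII_Prop3_2_iv_part
    | with_reducible exact N_AbsTopIII_Prop3_2_v_part
    | with_reducible exact N_AbsTopIII_Prop3_3_ii_part
    | with_reducible exact N_AbsTopIII_Prop4_2_i_part
    | with_reducible exact N_AbsTopIII_Prop4_2_ii_part
    | with_reducible exact N_AbsTopIII_Prop5_7_ii_part
    | with_reducible exact N_AbsTopIII_Prop5_8_i_part
    | with_reducible exact N_AbsTopIII_Prop5_8_ii_part
    | with_reducible exact N_AbsTopIII_Prop5_8_iii_part
    | with_reducible exact N_AbsTopIII_Thm1_9_part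

/-- `Layer4Residual2` (the apex's ONE L4 binder at v2) is KERNEL-INHABITED. Inhabited ≠ lead-discharged. [claim: Mochizuki2012, status: disputed] -/
theorem layer4Residual2_inhabited : Layer4Residual2.{u₁, u₂, u₃} :=
  ⟨layer4ResidualA2_inhabited, layer4ResidualB1_inhabited⟩

/-- The whole L4 slice at v2, AT THE INDEX LEVEL, is a kernel theorem: `Layer4ConeA2 ∧ Layer4ConeB1`. [claim: Mochizuki2012, status: disputed] -/
theorem layer4Cone2_inhabited : Layer4ConeA2.{u₁, u₂, u₃, u₄} ∧ Layer4ConeB1.{u₁, u₂, u₃} :=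
  layer4Cone2_of layer4Residual2_inhabited

end Summit.ABC.IUTFork.Conditional
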